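import Mathlib
import Literature.Probability.RandomMatrix.TwoQubitSeparabilityVolumesBlochFibre
import Literature.Probability.RandomMatrix.TwoQubitSeparabilityVolumesQubitFibreProofs
import HarnessLib

/-!
# The two-sided fibre volume over a general one-qubit marginal; reduction to the Bloch length

Support file for the proof of `ZhangJiangXie2025_qubit_blochFibre_lambdaMax_ratio`
(ZJX = Zhang–Jiang–Xie 2025, Prop. 6.10).

For a marginal `M = [[σ, z], [z̄, 1 − σ]]` we parametrize the trace-one Hermitian `4 × 4` matrices
with second-factor marginal `M` by `x ∈ ℝ¹²` exactly as in `qubitBlochFibreMatrix`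
(`Rmat σ z x = [[X, Z], [Zᴴ, M − X]]`), and put `F̃(σ, z) := vol₁₂ {x : 0 ≼ Rmat σ z x ≼ ½}`.

* **Covariance** (`Ftilde_eq_of_conj`): conjugation by `1 ⊗ U`, `U ∈ U(2)`, acts on the chart by a
  Lebesgue-measure-preserving linear map and moves the marginal `M ↦ U M U*`; hence `F̃` depends on
  `M` only through its spectrum, i.e. through the Bloch length `r = √((2σ−1)² + 4|z|²)`:
  `F̃(σ, z) = F(r)` (`Ftilde_eq_Fvol`), `F = Fvol` the fibre volume of the parent files.
* **Polar integration** (`lintegral_Ftilde`): for `σ ≥ ½`,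
  `∫ F̃(σ, z) dz = (π/2) ∫_{a > 2σ−1} F(a) a da`.
[folklore; ZJX §6.1 for the setting]
-/

open _root_.MeasureTheory Set Real Filter Topology
open scoped ENNReal ComplexOrder Matrix ComplexConjugate
open Complex Matrix

noncomputable section

namespace Literature.Probability.RandomMatrix

namespace ZhangJiangXie2025

/-! ## Blocks, coordinates and the general-marginal chart -/

/-- The upper-left block `X(x)`. [folklore] -/
def Xh (x : Fin 12 → ℝ) : Matrix (Fin 2) (Fin 2) ℂ :=
  !![((x 0 : ℝ) : ℂ), (⟨x 2, x 3⟩ : ℂ); (⟨x 2, -x 3⟩ : ℂ), ((x 1 : ℝ) : ℂ)]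

/-- The off-diagonal block `Z(x)`. [folklore] -/
def Zb (x : Fin 12 → ℝ) : Matrix (Fin 2) (Fin 2) ℂ :=
  !![(⟨x 4, x 5⟩ : ℂ), (⟨x 6, x 7⟩ : ℂ); (⟨x 8, x 9⟩ : ℂ), (⟨x 10, x 11⟩ : ℂ)]

/-- The marginal `M(σ, z) = [[σ, z], [z̄, 1 − σ]]`. [folklore] -/
def Mm (σ : ℝ) (z : ℂ) : Matrix (Fin 2) (Fin 2) ℂ :=
  !![((σ : ℝ) : ℂ), z; conj z, ((1 - σ : ℝ) : ℂ)]

/-- Real coordinates of a pair `(X, Z)` (`X` Hermitian). [folklore] -/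
def coords (X Z : Matrix (Fin 2) (Fin 2) ℂ) : Fin 12 → ℝ :=
  ![(X 0 0).re, (X 1 1).re, (X 0 1).re, (X 0 1).im, (Z 0 0).re, (Z 0 0).im, (Z 0 1).re, (Z 0 1).im,
    (Z 1 0).re, (Z 1 0).im, (Z 1 1).re, (Z 1 1).im]

/-- The general-marginal chart `Rmat σ z x = [[X, Z], [Zᴴ, M(σ,z) − X]]`. [folklore] -/
def Rmat (σ : ℝ) (z : ℂ) (x : Fin 12 → ℝ) : Matrix (Fin 4) (Fin 4) ℂ :=
  Matrix.reindex finSumFinEquiv finSumFinEquiv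
    (fromBlocks (Xh x) (Zb x) (Zb x)ᴴ (Mm σ z - Xh x))

/-- The lower-right block of `qubitBlochFibreMatrix`. [folklore] -/
def Ybl (a : ℝ) (x : Fin 12 → ℝ) : Matrix (Fin 2) (Fin 2) ℂ :=
  !![(((1 + a) / 2 - x 0 : ℝ) : ℂ), (⟨-x 2, -x 3⟩ : ℂ); (⟨-x 2, x 3⟩ : ℂ), (((1 - a) / 2 - x 1 : ℝ) : ℂ)]

/-- `qubitBlochFibreMatrix` as a glued block matrix. [folklore] -/
theorem qubitBlochFibreMatrix_eq_blocks (a : ℝ) (x : Fin 12 → ℝ) :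
    qubitBlochFibreMatrix a x =
      Matrix.reindex finSumFinEquiv finSumFinEquiv (fromBlocks (Xh x) (Zb x) (Zb x)ᴴ (Ybl a x)) := by
  ext i j
  fin_cases i <;> fin_cases j <;> rfl

/-- `Ybl a x = M((1+a)/2, 0) − X(x)`. [folklore] -/
theorem Ybl_eq (a : ℝ) (x : Fin 12 → ℝ) : Ybl a x = Mm ((1 + a) / 2) 0 - Xh x := by
  ext i j
  fin_cases i <;> fin_cases j <;> apply Complex.ext <;> simp [Ybl, Mm, Xh]
  all_goals ring

/-- **At `z = 0` the general chart is the Bloch-fibre chart**: `Rmat ((1+a)/2) 0 = ρ_a`. [folklore] -/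
theorem Rmat_bloch (a : ℝ) (x : Fin 12 → ℝ) : Rmat ((1 + a) / 2) 0 x = qubitBlochFibreMatrix a x := by
  rw [qubitBlochFibreMatrix_eq_blocks, Rmat, Ybl_eq]

/-- The two-sided fibre volume `F(a) = vol₁₂ {x : 0 ≼ ρ_a(x) ≼ ½}` in the Bloch length `a`.
[folklore] -/
def Fvol (a : ℝ) : ℝ≥0∞ :=
  volume {x : Fin 12 → ℝ | (qubitBlochFibreMatrix a x).PosSemidef ∧
    ((2 : ℂ)⁻¹ • (1 : Matrix (Fin 4) (Fin 4) ℂ) - qubitBlochFibreMatrix a x).PosSemidef}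

/-- The two-sided fibre volume over the marginal `M(σ, z)`. [folklore] -/
def Ftilde (σ : ℝ) (z : ℂ) : ℝ≥0∞ :=
  volume {x : Fin 12 → ℝ | (Rmat σ z x).PosSemidef ∧
    ((2 : ℂ)⁻¹ • (1 : Matrix (Fin 4) (Fin 4) ℂ) - Rmat σ z x).PosSemidef}

/-- `F̃((1+a)/2, 0) = F(a)`. [folklore] -/
theorem Ftilde_bloch (a : ℝ) : Ftilde ((1 + a) / 2) 0 = Fvol a := by
  simp only [Ftilde, Fvol, Rmat_bloch]

/-! ## Coordinates: round trips and linearity -/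

/-- `X(x)` is Hermitian. [folklore] -/
theorem isHermitian_Xh (x : Fin 12 → ℝ) : (Xh x).IsHermitian := by
  have : Xh x = !![((x 0 : ℝ) : ℂ), (⟨x 2, x 3⟩ : ℂ); conj (⟨x 2, x 3⟩ : ℂ), ((x 1 : ℝ) : ℂ)] := by
    ext i j; fin_cases i <;> fin_cases j <;> rfl
  rw [this]; exact isHermitian_fin_two _ _ _

/-- `M(σ, z)` is Hermitian. [folklore] -/
theorem isHermitian_Mm (σ : ℝ) (z : ℂ) : (Mm σ z).IsHermitian := isHermitian_fin_two _ _ _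

/-- `coords (X x) (Z x) = x`. [folklore] -/
theorem coords_Xh_Zb (x : Fin 12 → ℝ) : coords (Xh x) (Zb x) = x := by
  ext k; fin_cases k <;> simp [coords, Xh, Zb]

/-- `X (coords X Z) = X` for Hermitian `X`. [folklore] -/
theorem Xh_coords {X : Matrix (Fin 2) (Fin 2) ℂ} (hX : X.IsHermitian) (Z : Matrix (Fin 2) (Fin 2) ℂ) :
    Xh (coords X Z) = X := by
  have h00 : (X 0 0).im = 0 := by
    have := congrFun (congrFun hX 0) 0
    simp only [conjTranspose_apply, RCLike.star_def] at this
    have := congrArg Complex.im this; simp at this; linarith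
  have h11 : (X 1 1).im = 0 := by
    have := congrFun (congrFun hX 1) 1
    simp only [conjTranspose_apply, RCLike.star_def] at this
    have := congrArg Complex.im this; simp at this; linarith
  have h10 : X 1 0 = conj (X 0 1) := by
    have := congrFun (congrFun hX 1) 0
    simpa only [conjTranspose_apply, RCLike.star_def] using this.symm
  ext i j
  fin_cases i <;> fin_cases j <;> apply Complex.ext <;> simp [Xh, coords, h00, h11, h10]

/-- `Z (coords X Z) = Z`. [folklore] -/
theorem Zb_coords (X Z : Matrix (Fin 2) (Fin 2) ℂ) : Zb (coords X Z) = Z := by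
  ext i j
  fin_cases i <;> fin_cases j <;> apply Complex.ext <;> simp [Zb, coords]

/-- `X` is additive. [folklore] -/
theorem Xh_add (x y : Fin 12 → ℝ) : Xh (x + y) = Xh x + Xh y := by
  ext i j; fin_cases i <;> fin_cases j <;> apply Complex.ext <;> simp [Xh]
  all_goals ring

/-- `X` is homogeneous. [folklore] -/
theorem Xh_smul (c : ℝ) (x : Fin 12 → ℝ) : Xh (c • x) = (c : ℂ) • Xh x := by
  ext i j; fin_cases i <;> fin_cases j <;> apply Complex.ext <;> simp [Xh]

/-- `Z` is additive. [folklore] -/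
theorem Zb_add (x y : Fin 12 → ℝ) : Zb (x + y) = Zb x + Zb y := by
  ext i j; fin_cases i <;> fin_cases j <;> apply Complex.ext <;> simp [Zb]

/-- `Z` is homogeneous. [folklore] -/
theorem Zb_smul (c : ℝ) (x : Fin 12 → ℝ) : Zb (c • x) = (c : ℂ) • Zb x := by
  ext i j; fin_cases i <;> fin_cases j <;> apply Complex.ext <;> simp [Zb]

/-- `coords` is additive. [folklore] -/
theorem coords_add (X Z X' Z' : Matrix (Fin 2) (Fin 2) ℂ) :
    coords (X + X') (Z + Z') = coords X Z + coords X' Z' := by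
  ext k; fin_cases k <;> simp [coords]

/-- `coords` is homogeneous. [folklore] -/
theorem coords_smul (c : ℝ) (X Z : Matrix (Fin 2) (Fin 2) ℂ) :
    coords ((c : ℂ) • X) ((c : ℂ) • Z) = c • coords X Z := by
  ext k; fin_cases k <;> simp [coords]

/-! ## The action of `1 ⊗ U` on the chart -/

/-- Blockwise conjugation `(X, Z) ↦ (U X U*, U Z U*)` in the `12` real coordinates. [folklore] -/
def TB (U : Matrix (Fin 2) (Fin 2) ℂ) : (Fin 12 → ℝ) →ₗ[ℝ] (Fin 12 → ℝ) where
  toFun x := coords (U * Xh x * star U) (U * Zb x * star U)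
  map_add' x y := by
    rw [Xh_add, Zb_add, Matrix.mul_add, Matrix.add_mul, Matrix.mul_add, Matrix.add_mul, coords_add]
  map_smul' c x := by
    rw [Xh_smul, Zb_smul, Matrix.mul_smul, Matrix.smul_mul, Matrix.mul_smul, Matrix.smul_mul,
      coords_smul]
    rfl

/-- Unfolding lemma. [folklore] -/
theorem TB_apply (U : Matrix (Fin 2) (Fin 2) ℂ) (x : Fin 12 → ℝ) :
    TB U x = coords (U * Xh x * star U) (U * Zb x * star U) := rfl

/-- `X (T_U x) = U X(x) U*`. [folklore] -/
theorem Xh_TB (U : Matrix (Fin 2) (Fin 2) ℂ) (x : Fin 12 → ℝ) : Xh (TB U x) = U * Xh x * star U := by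
  rw [TB_apply]
  refine Xh_coords ?_ _
  have h := (isHermitian_Xh x)
  have : U * Xh x * star U = U * Xh x * Uᴴ := rfl
  rw [this]
  exact Matrix.isHermitian_mul_mul_conjTranspose _ h

/-- `Z (T_U x) = U Z(x) U*`. [folklore] -/
theorem Zb_TB (U : Matrix (Fin 2) (Fin 2) ℂ) (x : Fin 12 → ℝ) : Zb (TB U x) = U * Zb x * star U := by
  rw [TB_apply, Zb_coords]

/-- `T_{U*} ∘ T_U = id` for unitary `U`. [folklore] -/
theorem TB_star_TB {U : Matrix (Fin 2) (Fin 2) ℂ} (hU : U ∈ Matrix.unitaryGroup (Fin 2) ℂ)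
    (x : Fin 12 → ℝ) : TB (star U) (TB U x) = x := by
  have h1 : star U * U = 1 := Matrix.mem_unitaryGroup_iff'.mp hU
  rw [TB_apply, Xh_TB, Zb_TB, star_star]
  have e1 : star U * (U * Xh x * star U) * U = Xh x := by
    calc star U * (U * Xh x * star U) * U = (star U * U) * Xh x * (star U * U) := by
          simp only [Matrix.mul_assoc]
      _ = Xh x := by rw [h1, Matrix.one_mul, Matrix.mul_one]
  have e2 : star U * (U * Zb x * star U) * U = Zb x := by
    calc star U * (U * Zb x * star U) * U = (star U * U) * Zb x * (star U * U) := by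
          simp only [Matrix.mul_assoc]
      _ = Zb x := by rw [h1, Matrix.one_mul, Matrix.mul_one]
  rw [e1, e2, coords_Xh_Zb]

/-! ### The action on the chart matrix -/

/-- `Rmat` after `T_U`: blockwise conjugation, provided the marginal is moved accordingly. [folklore] -/
theorem Rmat_TB {U : Matrix (Fin 2) (Fin 2) ℂ} {σ σ' : ℝ} {z z' : ℂ}
    (hM : U * Mm σ z * star U = Mm σ' z') (x : Fin 12 → ℝ) :
    Rmat σ' z' (TB U x) =
      Matrix.reindex finSumFinEquiv finSumFinEquiv
        (fromBlocks (U * Xh x * star U) (U * Zb x * star U) (U * (Zb x)ᴴ * star U)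
          (U * (Mm σ z - Xh x) * star U)) := by
  rw [Rmat, Xh_TB, Zb_TB, ← hM]
  congr 2
  · rw [star_eq_conjTranspose, conjTranspose_mul, conjTranspose_mul, conjTranspose_conjTranspose,
      Matrix.mul_assoc]
  · rw [Matrix.mul_sub, Matrix.sub_mul]

/-- `½·1₄ − reindex (fromBlocks A B C D) = reindex (fromBlocks (½ − A) (−B) (−C) (½ − D))`.
[folklore] -/
theorem half_sub_reindex_fromBlocks (A B C D : Matrix (Fin 2) (Fin 2) ℂ) :
    (2 : ℂ)⁻¹ • (1 : Matrix (Fin 4) (Fin 4) ℂ) -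
        Matrix.reindex finSumFinEquiv finSumFinEquiv (fromBlocks A B C D) =
      Matrix.reindex finSumFinEquiv finSumFinEquiv
        (fromBlocks ((2 : ℂ)⁻¹ • 1 - A) (-B) (-C) ((2 : ℂ)⁻¹ • 1 - D)) := by
  have h0 : fromBlocks ((2 : ℂ)⁻¹ • (1 : Matrix (Fin 2) (Fin 2) ℂ)) 0 0 ((2 : ℂ)⁻¹ • 1) =
      (2 : ℂ)⁻¹ • (1 : Matrix (Fin 2 ⊕ Fin 2) (Fin 2 ⊕ Fin 2) ℂ) := by
    conv_rhs => rw [← fromBlocks_one, fromBlocks_smul, smul_zero]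
  have h1 : (2 : ℂ)⁻¹ • (1 : Matrix (Fin 4) (Fin 4) ℂ) =
      Matrix.reindex finSumFinEquiv finSumFinEquiv
        (fromBlocks ((2 : ℂ)⁻¹ • 1) 0 0 ((2 : ℂ)⁻¹ • 1) : Matrix (Fin 2 ⊕ Fin 2) (Fin 2 ⊕ Fin 2) ℂ) := by
    rw [h0, reindex_apply]
    ext i j
    simp [one_apply]
  have h2 : fromBlocks ((2 : ℂ)⁻¹ • (1 : Matrix (Fin 2) (Fin 2) ℂ)) 0 0 ((2 : ℂ)⁻¹ • 1) -
      fromBlocks A B C D = fromBlocks ((2 : ℂ)⁻¹ • 1 - A) (-B) (-C) ((2 : ℂ)⁻¹ • 1 - D) := by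
    rw [sub_eq_add_neg, fromBlocks_neg, fromBlocks_add]
    simp [sub_eq_add_neg]
  rw [h1, reindex_apply, reindex_apply, ← h2]
  rfl

/-- `U (½·1) U* = ½·1` for unitary `U`. [folklore] -/
theorem unitary_conj_half {U : Matrix (Fin 2) (Fin 2) ℂ} (hU : U ∈ Matrix.unitaryGroup (Fin 2) ℂ) :
    U * ((2 : ℂ)⁻¹ • (1 : Matrix (Fin 2) (Fin 2) ℂ)) * star U = (2 : ℂ)⁻¹ • 1 := by
  have h2 : U * star U = 1 := Matrix.mem_unitaryGroup_iff.mp hU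
  rw [Matrix.mul_smul, Matrix.mul_one, Matrix.smul_mul, h2]

/-- **Invariance of the two-sided body under `1 ⊗ U`.** [folklore] -/
theorem mem_twoSided_TB_iff {U : Matrix (Fin 2) (Fin 2) ℂ} (hU : U ∈ Matrix.unitaryGroup (Fin 2) ℂ)
    {σ σ' : ℝ} {z z' : ℂ} (hM : U * Mm σ z * star U = Mm σ' z') (x : Fin 12 → ℝ) :
    ((Rmat σ' z' (TB U x)).PosSemidef ∧
        ((2 : ℂ)⁻¹ • (1 : Matrix (Fin 4) (Fin 4) ℂ) - Rmat σ' z' (TB U x)).PosSemidef) ↔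
      ((Rmat σ z x).PosSemidef ∧
        ((2 : ℂ)⁻¹ • (1 : Matrix (Fin 4) (Fin 4) ℂ) - Rmat σ z x).PosSemidef) := by
  have hU' : U * star U = 1 := Matrix.mem_unitaryGroup_iff.mp hU
  rw [Rmat_TB hM]
  refine and_congr ?_ ?_
  · rw [reindex_apply, posSemidef_submatrix_equiv, posSemidef_fromBlocks_conj_iff hU', Rmat,
      reindex_apply, posSemidef_submatrix_equiv]
  · rw [half_sub_reindex_fromBlocks, reindex_apply, posSemidef_submatrix_equiv, Rmat,
      half_sub_reindex_fromBlocks, reindex_apply, posSemidef_submatrix_equiv]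
    have e1 : (2 : ℂ)⁻¹ • 1 - U * Xh x * star U = U * ((2 : ℂ)⁻¹ • 1 - Xh x) * star U := by
      rw [Matrix.mul_sub, Matrix.sub_mul, unitary_conj_half hU]
    have e2 : -(U * Zb x * star U) = U * (-Zb x) * star U := by
      rw [Matrix.mul_neg, Matrix.neg_mul]
    have e3 : -(U * (Zb x)ᴴ * star U) = U * (-(Zb x)ᴴ) * star U := by
      rw [Matrix.mul_neg, Matrix.neg_mul]
    have e4 : (2 : ℂ)⁻¹ • 1 - U * (Mm σ z - Xh x) * star U =
        U * ((2 : ℂ)⁻¹ • 1 - (Mm σ z - Xh x)) * star U := by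
      rw [Matrix.mul_sub U ((2 : ℂ)⁻¹ • 1), Matrix.sub_mul, unitary_conj_half hU]
    rw [e1, e2, e3, e4, posSemidef_fromBlocks_conj_iff hU']

/-! ### `T_U` preserves Lebesgue measure -/

/-- The Frobenius gauge `‖X‖² + ‖Z‖²` in coordinates. [folklore] -/
def frob (x : Fin 12 → ℝ) : ℝ :=
  x 0 ^ 2 + x 1 ^ 2 + 2 * (x 2 ^ 2 + x 3 ^ 2) +
    (x 4 ^ 2 + x 5 ^ 2 + x 6 ^ 2 + x 7 ^ 2 + x 8 ^ 2 + x 9 ^ 2 + x 10 ^ 2 + x 11 ^ 2)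

/-- `frob x = Re tr (X²) + Re tr (Zᴴ Z)`. [folklore] -/
theorem frob_eq_trace (x : Fin 12 → ℝ) :
    frob x = (Matrix.trace (Xh x * Xh x)).re + (Matrix.trace ((Zb x)ᴴ * Zb x)).re := by
  simp [Matrix.trace, Matrix.mul_apply, Fin.sum_univ_succ, Xh, Zb, conjTranspose_apply, frob]
  ring

/-- `frob` is invariant under `T_U`, `U` unitary. [folklore] -/
theorem frob_TB {U : Matrix (Fin 2) (Fin 2) ℂ} (hU : U ∈ Matrix.unitaryGroup (Fin 2) ℂ)
    (x : Fin 12 → ℝ) : frob (TB U x) = frob x := by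
  have h1 : star U * U = 1 := Matrix.mem_unitaryGroup_iff'.mp hU
  rw [frob_eq_trace, frob_eq_trace, Xh_TB, Zb_TB]
  have e1 : U * Xh x * star U * (U * Xh x * star U) = U * (Xh x * Xh x) * star U := by
    calc U * Xh x * star U * (U * Xh x * star U) = U * Xh x * (star U * U) * Xh x * star U := by
          simp only [Matrix.mul_assoc]
      _ = U * (Xh x * Xh x) * star U := by rw [h1, Matrix.mul_one, Matrix.mul_assoc U]
  have e2 : (U * Zb x * star U)ᴴ * (U * Zb x * star U) = U * ((Zb x)ᴴ * Zb x) * star U := by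
    rw [star_eq_conjTranspose, conjTranspose_mul, conjTranspose_mul, conjTranspose_conjTranspose]
    calc U * ((Zb x)ᴴ * Uᴴ) * (U * Zb x * Uᴴ) = U * (Zb x)ᴴ * (Uᴴ * U) * Zb x * Uᴴ := by
          simp only [Matrix.mul_assoc]
      _ = U * ((Zb x)ᴴ * Zb x) * Uᴴ := by
          rw [show Uᴴ * U = 1 from h1, Matrix.mul_one, Matrix.mul_assoc U]
  rw [e1, e2, Matrix.trace_mul_cycle U, Matrix.trace_mul_cycle U, h1, Matrix.one_mul,
    Matrix.one_mul]

/-- The gauge ball. [folklore] -/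
def frobBall : Set (Fin 12 → ℝ) := {x | frob x ≤ 1}

/-- `T_U` maps the gauge ball onto itself. [folklore] -/
theorem TB_image_frobBall {U : Matrix (Fin 2) (Fin 2) ℂ} (hU : U ∈ Matrix.unitaryGroup (Fin 2) ℂ) :
    TB U '' frobBall = frobBall := by
  have hU' : star U ∈ Matrix.unitaryGroup (Fin 2) ℂ := Unitary.star_mem hU
  ext y
  constructor
  · rintro ⟨x, hx, rfl⟩
    simp only [frobBall, mem_setOf_eq] at hx ⊢
    rwa [frob_TB hU]
  · intro hy
    refine ⟨TB (star U) y, ?_, ?_⟩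
    · simp only [frobBall, mem_setOf_eq] at hy ⊢
      rwa [frob_TB hU']
    · have := TB_star_TB hU' y
      rwa [star_star] at this

/-- The gauge ball contains a cube, hence has positive volume. [folklore] -/
theorem volume_frobBall_pos : 0 < volume frobBall := by
  have hsub : Metric.ball (0 : Fin 12 → ℝ) (1 / 4) ⊆ frobBall := by
    intro x hx
    rw [mem_ball_zero_iff, pi_norm_lt_iff (by norm_num)] at hx
    have h : ∀ k, x k ^ 2 ≤ 1 / 16 := by
      intro k
      have := abs_lt.mp (by simpa [Real.norm_eq_abs] using hx k)
      nlinarith [this.1, this.2]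
    simp only [frobBall, mem_setOf_eq, frob]
    linarith [h 0, h 1, h 2, h 3, h 4, h 5, h 6, h 7, h 8, h 9, h 10, h 11]
  exact lt_of_lt_of_le (Metric.measure_ball_pos volume _ (by norm_num)) (measure_mono hsub)

/-- The gauge ball lies in a cube, hence has finite volume. [folklore] -/
theorem volume_frobBall_lt_top : volume frobBall < ⊤ := by
  have hsub : frobBall ⊆ Metric.closedBall (0 : Fin 12 → ℝ) 1 := by
    intro x hx
    simp only [frobBall, mem_setOf_eq, frob] at hx
    rw [mem_closedBall_zero_iff, pi_norm_le_iff_of_nonneg (by norm_num)]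
    intro k
    have s0 := sq_nonneg (x 0); have s1 := sq_nonneg (x 1); have s2 := sq_nonneg (x 2)
    have s3 := sq_nonneg (x 3); have s4 := sq_nonneg (x 4); have s5 := sq_nonneg (x 5)
    have s6 := sq_nonneg (x 6); have s7 := sq_nonneg (x 7); have s8 := sq_nonneg (x 8)
    have s9 := sq_nonneg (x 9); have s10 := sq_nonneg (x 10); have s11 := sq_nonneg (x 11)
    have hk : x k ^ 2 ≤ x 0 ^ 2 + x 1 ^ 2 + 2 * (x 2 ^ 2 + x 3 ^ 2) +
        (x 4 ^ 2 + x 5 ^ 2 + x 6 ^ 2 + x 7 ^ 2 + x 8 ^ 2 + x 9 ^ 2 + x 10 ^ 2 + x 11 ^ 2) := by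
      fin_cases k <;> simp <;> linarith
    have hk1 : x k ^ 2 ≤ 1 := hk.trans hx
    rw [Real.norm_eq_abs, abs_le]
    constructor
    · nlinarith [sq_nonneg (x k + 1)]
    · nlinarith [sq_nonneg (x k - 1)]
  exact lt_of_le_of_lt (measure_mono hsub) measure_closedBall_lt_top

/-- `|det T_U| = 1` for unitary `U`. [folklore] -/
theorem abs_det_TB {U : Matrix (Fin 2) (Fin 2) ℂ} (hU : U ∈ Matrix.unitaryGroup (Fin 2) ℂ) :
    |LinearMap.det (TB U)| = 1 := by
  have h := Measure.addHaar_image_linearMap volume (TB U) frobBall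
  rw [TB_image_frobBall hU] at h
  have h1 : ENNReal.ofReal |LinearMap.det (TB U)| = 1 := by
    have := (ENNReal.mul_eq_right volume_frobBall_pos.ne' volume_frobBall_lt_top.ne).mp h.symm
    exact this
  have := congrArg ENNReal.toReal h1
  rwa [ENNReal.toReal_ofReal (abs_nonneg _), ENNReal.toReal_one] at this

/-- **`T_U` preserves Lebesgue measure** (as a statement on preimages). [folklore] -/
theorem volume_preimage_TB {U : Matrix (Fin 2) (Fin 2) ℂ} (hU : U ∈ Matrix.unitaryGroup (Fin 2) ℂ)
    (S : Set (Fin 12 → ℝ)) : volume (TB U ⁻¹' S) = volume S := by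
  have hdet : LinearMap.det (TB U) ≠ 0 := by
    intro h; have := abs_det_TB hU; rw [h, abs_zero] at this; exact zero_ne_one this
  rw [Measure.addHaar_preimage_linearMap volume hdet, abs_inv, abs_det_TB hU, inv_one,
    ENNReal.ofReal_one, one_mul]

/-! ## Covariance of `F̃` -/

/-- **Covariance**: if `U M(σ,z) U* = M(σ',z')` for a unitary `U` then `F̃(σ,z) = F̃(σ',z')`.
[folklore] -/
theorem Ftilde_eq_of_conj {U : Matrix (Fin 2) (Fin 2) ℂ} (hU : U ∈ Matrix.unitaryGroup (Fin 2) ℂ)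
    {σ σ' : ℝ} {z z' : ℂ} (hM : U * Mm σ z * star U = Mm σ' z') : Ftilde σ z = Ftilde σ' z' := by
  unfold Ftilde
  have hset : {x : Fin 12 → ℝ | (Rmat σ z x).PosSemidef ∧
      ((2 : ℂ)⁻¹ • (1 : Matrix (Fin 4) (Fin 4) ℂ) - Rmat σ z x).PosSemidef} =
      TB U ⁻¹' {x : Fin 12 → ℝ | (Rmat σ' z' x).PosSemidef ∧
        ((2 : ℂ)⁻¹ • (1 : Matrix (Fin 4) (Fin 4) ℂ) - Rmat σ' z' x).PosSemidef} := by
    ext x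
    simp only [mem_setOf_eq, mem_preimage]
    exact (mem_twoSided_TB_iff hU hM x).symm
  rw [hset, volume_preimage_TB hU]

/-- The swap unitary. [folklore] -/
def swapU : Matrix (Fin 2) (Fin 2) ℂ := !![0, 1; 1, 0]

/-- `swapU` is unitary. [folklore] -/
theorem swapU_mem : swapU ∈ Matrix.unitaryGroup (Fin 2) ℂ := by
  rw [Matrix.mem_unitaryGroup_iff]
  ext i j
  fin_cases i <;> fin_cases j <;> simp [swapU, Matrix.mul_apply, Fin.sum_univ_succ, one_apply]

/-- The swap exchanges the diagonal marginals `M((1+a)/2, 0) ↔ M((1−a)/2, 0)`. [folklore] -/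
theorem swapU_conj_Mm (a : ℝ) :
    swapU * Mm ((1 + a) / 2) 0 * star swapU = Mm ((1 + -a) / 2) 0 := by
  ext i j
  fin_cases i <;> fin_cases j <;> apply Complex.ext <;>
    simp [swapU, Mm, Matrix.mul_apply, Fin.sum_univ_succ, conjTranspose_apply,
      star_eq_conjTranspose] <;> ring

/-- **`F` is even**: `F(−a) = F(a)`. [folklore] -/
theorem Fvol_neg (a : ℝ) : Fvol (-a) = Fvol a := by
  rw [← Ftilde_bloch, ← Ftilde_bloch]
  exact (Ftilde_eq_of_conj swapU_mem (swapU_conj_Mm a)).symm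

/-- The Bloch length of the marginal `M(σ, z)`. [folklore] -/
def blochLen (σ : ℝ) (z : ℂ) : ℝ := Real.sqrt ((2 * σ - 1) ^ 2 + 4 * normSq z)

/-- `tr M(σ, z) = 1`. [folklore] -/
theorem trace_Mm (σ : ℝ) (z : ℂ) : (Mm σ z).trace = 1 := by
  rw [Matrix.trace_fin_two]
  apply Complex.ext <;> simp [Mm]

/-- `det M(σ, z) = σ(1−σ) − |z|²`. [folklore] -/
theorem det_Mm (σ : ℝ) (z : ℂ) : (Mm σ z).det = ((σ * (1 - σ) - normSq z : ℝ) : ℂ) := by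
  rw [Matrix.det_fin_two]
  apply Complex.ext
  · simp [Mm, Complex.mul_re, normSq_apply]
  · simp [Mm, Complex.mul_im]; ring

/-- A real diagonal `2 × 2` matrix with trace `1` is `M(f₀, 0)`. [folklore] -/
theorem diagonal_eq_Mm (f : Fin 2 → ℝ) (hf : f 0 + f 1 = 1) :
    Matrix.diagonal (RCLike.ofReal ∘ f) = Mm (f 0) 0 := by
  have h1 : f 1 = 1 - f 0 := by linarith
  ext i j
  fin_cases i <;> fin_cases j
  · simp [Mm, Matrix.diagonal]
  · simp [Mm, Matrix.diagonal]
  · simp [Mm, Matrix.diagonal]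
  · simp [Mm, Matrix.diagonal, h1]

/-- `tr M(σ,z) = 1`, `det M(σ,z) = σ(1−σ) − |z|²`; hence for the (real) spectrum `{μ₀, μ₁}`:
`μ₀ + μ₁ = 1` and `(μ₀ − μ₁)² = r²`. This lemma: the diagonalizing unitary of the spectral theorem
conjugates `M(σ,z)` to `M(μ₀, 0)` with `(2μ₀ − 1)² = r²`. [folklore] -/
theorem exists_conj_Mm_diag (σ : ℝ) (z : ℂ) :
    ∃ U ∈ Matrix.unitaryGroup (Fin 2) ℂ, ∃ μ : ℝ,
      U * Mm σ z * star U = Mm μ 0 ∧ (2 * μ - 1) ^ 2 = blochLen σ z ^ 2 := by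
  have hA : (Mm σ z).IsHermitian := isHermitian_Mm σ z
  -- spectral theorem: `Mm = V D V*`, `V = eigenvectorUnitary`
  have hspec : Mm σ z = (hA.eigenvectorUnitary : Matrix (Fin 2) (Fin 2) ℂ) *
      Matrix.diagonal (RCLike.ofReal ∘ hA.eigenvalues) *
        star (hA.eigenvectorUnitary : Matrix (Fin 2) (Fin 2) ℂ) := by
    have := hA.spectral_theorem
    rwa [Unitary.conjStarAlgAut_apply] at this
  set V : Matrix (Fin 2) (Fin 2) ℂ := (hA.eigenvectorUnitary : Matrix (Fin 2) (Fin 2) ℂ) with hV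
  have hVmem : V ∈ Matrix.unitaryGroup (Fin 2) ℂ := hA.eigenvectorUnitary.2
  have hV1 : star V * V = 1 := Matrix.mem_unitaryGroup_iff'.mp hVmem
  have hdiag : star V * Mm σ z * V = Matrix.diagonal (RCLike.ofReal ∘ hA.eigenvalues) := by
    calc star V * Mm σ z * V
        = star V * (V * Matrix.diagonal (RCLike.ofReal ∘ hA.eigenvalues) * star V) * V := by
          rw [← hspec]
      _ = (star V * V) * Matrix.diagonal (RCLike.ofReal ∘ hA.eigenvalues) * (star V * V) := by
          simp only [Matrix.mul_assoc]
      _ = Matrix.diagonal (RCLike.ofReal ∘ hA.eigenvalues) := by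
          rw [hV1, Matrix.one_mul, Matrix.mul_one]
  -- trace and determinant
  have htr : hA.eigenvalues 0 + hA.eigenvalues 1 = 1 := by
    have h := hA.trace_eq_sum_eigenvalues
    rw [Fin.sum_univ_two, trace_Mm] at h
    have := congrArg Complex.re h
    simp at this
    linarith
  have hdet : hA.eigenvalues 0 * hA.eigenvalues 1 = σ * (1 - σ) - normSq z := by
    have h := hA.det_eq_prod_eigenvalues
    rw [Fin.prod_univ_two, det_Mm] at h
    have := congrArg Complex.re h
    simp at this
    linarith
  refine ⟨star V, Unitary.star_mem hVmem, hA.eigenvalues 0, ?_, ?_⟩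
  · rw [star_star, hdiag]
    exact diagonal_eq_Mm _ htr
  · rw [blochLen, Real.sq_sqrt (by nlinarith [normSq_nonneg z, sq_nonneg (2 * σ - 1)])]
    linear_combination (-4) * hdet + (4 * hA.eigenvalues 0) * htr

/-- **`F̃` depends only on the Bloch length**: `F̃(σ, z) = F(r)`, `r = √((2σ−1)² + 4|z|²)`.
[folklore] -/
theorem Ftilde_eq_Fvol (σ : ℝ) (z : ℂ) : Ftilde σ z = Fvol (blochLen σ z) := by
  obtain ⟨U, hU, μ, hM, hμ⟩ := exists_conj_Mm_diag σ z
  rw [Ftilde_eq_of_conj hU hM]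
  have hr : 0 ≤ blochLen σ z := Real.sqrt_nonneg _
  have : μ = (1 + (2 * μ - 1)) / 2 := by ring
  rw [this, Ftilde_bloch]
  -- `(2μ−1)² = r²` gives `2μ − 1 = ± r`
  have h2 : 2 * μ - 1 = blochLen σ z ∨ 2 * μ - 1 = -blochLen σ z := by
    have := hμ
    rcases (sq_eq_sq_iff_eq_or_eq_neg).mp this with h' | h'
    · exact Or.inl h'
    · exact Or.inr h'
  rcases h2 with h2 | h2
  · rw [h2]
  · rw [h2, Fvol_neg]

/-! ## Measurability of `F` -/

/-- The graph set `{(a, x) : 0 ≼ ρ_a(x) ≼ ½}` is closed. [folklore] -/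
theorem isClosed_blochGraph :
    IsClosed {p : ℝ × (Fin 12 → ℝ) | (qubitBlochFibreMatrix p.1 p.2).PosSemidef ∧
      ((2 : ℂ)⁻¹ • (1 : Matrix (Fin 4) (Fin 4) ℂ) - qubitBlochFibreMatrix p.1 p.2).PosSemidef} := by
  have hc : Continuous fun p : ℝ × (Fin 12 → ℝ) => qubitBlochFibreMatrix p.1 p.2 := by
    refine continuous_matrix fun i j => ?_
    fin_cases i <;> fin_cases j <;> simp [qubitBlochFibreMatrix] <;> first
      | fun_prop
      | (apply continuous_cmk <;> fun_prop)
  exact (isClosed_posSemidef.preimage hc).inter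
    (isClosed_posSemidef.preimage (continuous_const.sub hc))

/-- `F` is measurable. [folklore] -/
theorem measurable_Fvol : Measurable Fvol :=
  measurable_measure_prodMk_left (ν := (volume : Measure (Fin 12 → ℝ)))
    isClosed_blochGraph.measurableSet

/-! ## Polar integration over the off-diagonal marginal entry -/

/-- The one-dimensional substitution `s = (a² − x²)/4` on `(x, ∞)`, `x ≥ 0`. [folklore] -/
theorem lintegral_Ioi_sqrt_subst {x : ℝ} (hx : 0 ≤ x) (G : ℝ → ℝ≥0∞) :
    ∫⁻ s in Ioi (0 : ℝ), G (Real.sqrt (x ^ 2 + 4 * s)) =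
      ∫⁻ a in Ioi x, ENNReal.ofReal (a / 2) * G a := by
  set f : ℝ → ℝ := fun a => (a ^ 2 - x ^ 2) / 4 with hf
  have himg : f '' Ioi x = Ioi 0 := by
    ext s
    constructor
    · rintro ⟨a, ha, rfl⟩
      simp only [mem_Ioi] at ha ⊢
      rw [hf]; dsimp only
      have : x ^ 2 < a ^ 2 := by nlinarith
      linarith
    · intro hs
      refine ⟨Real.sqrt (x ^ 2 + 4 * s), ?_, ?_⟩
      · simp only [mem_Ioi] at hs ⊢
        calc x = Real.sqrt (x ^ 2) := (Real.sqrt_sq hx).symm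
          _ < Real.sqrt (x ^ 2 + 4 * s) := Real.sqrt_lt_sqrt (sq_nonneg _) (by linarith)
      · rw [hf]; dsimp only
        rw [Real.sq_sqrt (by simp only [mem_Ioi] at hs; positivity)]
        ring
  have hderiv : ∀ a ∈ Ioi x, HasDerivWithinAt f (a / 2) (Ioi x) a := by
    intro a _
    have : HasDerivAt f (a / 2) a := by
      rw [hf]
      have h1 : HasDerivAt (fun a : ℝ => (a ^ 2 - x ^ 2) / 4) ((2 * a - 0) / 4) a :=
        ((hasDerivAt_pow 2 a |>.sub (hasDerivAt_const a (x ^ 2))) |>.div_const 4) |>.congr_deriv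
          (by simp)
      convert h1 using 1; ring
    exact this.hasDerivWithinAt
  have hinj : InjOn f (Ioi x) := by
    intro a ha b hb hab
    simp only [mem_Ioi] at ha hb
    rw [hf] at hab; dsimp only at hab
    have : a ^ 2 = b ^ 2 := by linarith
    nlinarith
  rw [← himg, lintegral_image_eq_lintegral_abs_deriv_mul measurableSet_Ioi hderiv hinj]
  refine setLIntegral_congr_fun measurableSet_Ioi fun a ha => ?_
  simp only [mem_Ioi] at ha
  have ha0 : 0 < a := hx.trans_lt ha
  rw [abs_of_pos (by linarith), hf]
  dsimp only
  congr 2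
  rw [show x ^ 2 + 4 * ((a ^ 2 - x ^ 2) / 4) = a ^ 2 by ring, Real.sqrt_sq ha0.le]

/-- **Slice integral of the fibre volume**: for `σ ≥ ½`,
`∫ F̃(σ, z) dz = (π/2) · ∫_{a > 2σ−1} F(a) · a da`. [folklore] -/
theorem lintegral_Ftilde {σ : ℝ} (hσ : 1 / 2 ≤ σ) :
    ∫⁻ z, Ftilde σ z = ENNReal.ofReal (π / 2) * ∫⁻ a in Ioi (2 * σ - 1), Fvol a * ENNReal.ofReal a := by
  have hx : 0 ≤ 2 * σ - 1 := by linarith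
  simp_rw [Ftilde_eq_Fvol, blochLen]
  have hG : Measurable fun s : ℝ => Fvol (Real.sqrt ((2 * σ - 1) ^ 2 + 4 * s)) :=
    measurable_Fvol.comp (by fun_prop)
  rw [lintegral_comp_normSq (fun s => Fvol (Real.sqrt ((2 * σ - 1) ^ 2 + 4 * s))) hG,
    lintegral_Ioi_sqrt_subst hx Fvol]
  have : ∀ a : ℝ, ENNReal.ofReal (a / 2) * Fvol a = ENNReal.ofReal (1 / 2) * (Fvol a * ENNReal.ofReal a) := by
    intro a
    rw [show a / 2 = 1 / 2 * a by ring]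
    rcases le_or_gt 0 a with ha | ha
    · rw [ENNReal.ofReal_mul (by norm_num)]; ring
    · rw [ENNReal.ofReal_of_nonpos (by nlinarith), ENNReal.ofReal_of_nonpos ha.le]; simp
  simp_rw [this]
  rw [lintegral_const_mul' _ (fun a => Fvol a * ENNReal.ofReal a) ENNReal.ofReal_ne_top,
    ← mul_assoc, ← ENNReal.ofReal_mul pi_pos.le]
  congr 2
  ring

end ZhangJiangXie2025

end Literature.Probability.RandomMatrix

end
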